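/-
Copyright (c) 2026 the pub-hodgecm-mathlib formalisation cell (harness21).  Prover seat hodgecm-mathlib-K2E1-p08 (g4), Track B ∕ K2-LIT, h413 =
`stmt-HodgeConjecture-24833`, line `K2_E1_TraceFormulaBeta`, campaign «EIS-RANK-ONE» rung R2 «Godement» at `N = 2`; DEAL BY NAME of the dealer K2E1-plan (g3) 2026-09-04T05:13:55Z (1):
Godement's criterion for `U(Φ₂) = U(1,1)` over a CM field, UNCONDITIONAL (★ (G2) at E5-U2 = ★ p857484 K2E4-p11 (g3)) — the 5Res rails.
-/
import Summits.HodgeConjecture.HodgeConjecture.Theorems.K2E1BorelParabolicReductionU     -- ★ p857450 (G2) (this seat): E5 ⟹ E4 ⟹ Summable, any `N`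
import Summits.HodgeConjecture.HodgeConjecture.Theorems.K2E1BorelEisensteinGodementU3    -- ★ p857434 (G′) (this seat): the `flatSectionU` comparison lemmas
import Summits.HodgeConjecture.HodgeConjecture.Theorems.K2E1BorelParabolicIntegralU2    -- ★ p857484 (K2E4-p11 (g3)): E5-U2 `parabolicIntegral_borel_two` for `τ > 1`
import HarnessLib

/-!
# K2·E1 — `K2E1BorelEisensteinGodementCMTwo`: GODEMENT'S CRITERION FOR `U(1,1)` — THE BOREL EISENSTEIN SERIES `E(f_z)(g) = Σ_{γ ∈ B(F)∖G(F)} φ(γg) H(γg)^z` OF `U(J₂)`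
# CONVERGES ABSOLUTELY, LOCALLY UNIFORMLY IN `g`, FOR `Re z > 1` (`Re s > ½`) — UNCONDITIONAL (campaign EIS-RANK-ONE, rung R2 closed at `N = 2`, E1-native)

Track B ∕ K2-LIT, crux h413 = `stmt-HodgeConjecture-24833`, route of record `HCCMUnconditional`; cell `hodgecm-mathlib`, squad K2, ENGINE E1.  Prover seat
`hodgecm-mathlib-K2E1-p08` (g4); DEAL BY NAME (K2E1-plan (g3) 05:13:55Z, (1)).  THEOREMS ONLY (no `def`, no `instance`, no notation, no named-fact hypothesis, no `sorry`); lane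
`--kind proof --supports stmt-HodgeConjecture-24833 --as helper` (count-neutral).  The `N = 2` twin of ★ `K2E1BorelEisensteinGodementCMThree`: the SAME ★ chain (G0) → (G) → (G2)
(all `N`-generic) closed by ★ (G3-U2) `K2E1BorelParabolicIntegralU2.parabolicIntegral_borel_two` (`δ_B = H` at `N = 2`, so E5 holds for `τ > 1 = 2ρ_H`).  A second,
transport-free road to Godement at `N = 2` next to ★ p857351 ∕ p857393 (K2Liu junction), in E1-NATIVE currency with the locally uniform majorant — the 5Res rails.
* `summable_borelHeight_rpow_two` — any quadratic `(F, E, c)` (`c² = 1`, `c ≠ 1`) with Iwasawa: `1 < τ ⟹ ∀ g, Summable (q ↦ H(γ̃_q g)^τ)`; `exists_nhds_summable_majorant_borelHeight_rpow_two`.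
* **`summable_borelHeight_rpow_cm_two (L) (hτ : 1 < τ)`**, **`summable_eisensteinSeriesU_flatSectionU_cm_two (L) (hz : 1 < z.re) (hφ : ‖φ‖ ≤ M) : ∀ g, Summable (q ↦ ‖flatSectionU φ z (γ̃_q * g)‖)`**,
  **`exists_locallyUniform_majorant_flatSectionU_cm_two`** (R4a shape), `exists_nhds_summable_majorant_borelHeight_rpow_cm_two` — at the CM pair `(L⁺, L, c)`, no hypothesis left.
[MoeglinWaldspurger1995 II.1.5 Prop.; Godement1964 §8; Garrett2018 §2.8 (GL₂-type rank one), Cor. 3.10.2; Rogawski1990 §2.2.]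
HONEST LABEL: HC_CM is proved only modulo the 7 printed citations (2 remaining named inputs: hLiu418 = `stmt-HodgeConjecture-24832`, h413 = `stmt-HodgeConjecture-24833`) until rung 0
closes; count-neutral helper, proves no printed statement, closes no socket.
-/

set_option autoImplicit false
-- the mandated namespace repeats the single-problem summit's segment (`HodgeConjecture.HodgeConjecture`)
set_option linter.dupNamespace false

noncomputable section

open MeasureTheory MeasureTheory.Measure Set Filter Topology MulAction NumberField IsDedekindDomain
open scoped ENNReal NNReal Pointwise MatrixGroups
open Literature.MeasureTheory.Group
open Literature.NumberTheory.Automorphic Literature.NumberTheory.Automorphic.UnitaryGroup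
open Summit.HodgeConjecture.HodgeConjecture.Cruxes.H413.K2E1BorelEisensteinU
open Summit.HodgeConjecture.HodgeConjecture.Cruxes.H413.K2E1BorelEisensteinGodementU
open Summit.HodgeConjecture.HodgeConjecture.Cruxes.H413.K2E1BorelEisensteinGodementU3
open Summit.HodgeConjecture.HodgeConjecture.Cruxes.H413.K2E1BorelParabolicReductionU
open Summit.HodgeConjecture.HodgeConjecture.Cruxes.H413.K2E1BorelParabolicIntegralU2

namespace Summit.HodgeConjecture.HodgeConjecture.Cruxes.H413.K2E1BorelEisensteinGodementCMTwo

/-! ## §1 Any quadratic `(F, E, c)` with the Iwasawa decomposition -/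

section Quadratic

variable {F E : Type} [Field F] [NumberField F] [Field E] [NumberField E] [Algebra F E] {c : E ≃ₐ[F] E}

/-- **GODEMENT FOR `U(J₂)`, any quadratic `(F, E, c)` with Iwasawa**: `1 < τ ⟹ ∀ g, Summable (q ↦ H(γ̃_q g)^τ)` (★ (G2) at ★ `parabolicIntegral_borel_two`; the Haar measure is chosen inside).
[cite: Godement1964, §8] [cite: MoeglinWaldspurger1995, II.1.5] [cite: Garrett2018, §2.8] -/
theorem summable_borelHeight_rpow_two (hc : c * c = 1) (hc1 : c ≠ 1)
    (hIw : ∀ g : (quasiSplit F E c 2).Adelic, ∃ b ∈ borelAdelic F E c 2, ∃ k : (quasiSplit F E c 2).Adelic,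
      adelicVal F E c 2 ((StdForm.antidiagonal 2).over E) k ∈ standardMaximalCompactGL 2 E ∧ g = b * k)
    {τ : ℝ} (hτ : 1 < τ) :
    ∀ g : (quasiSplit F E c 2).Adelic,
      Summable fun q : Quotient (orbitRel ↥(borelU (c : E →+* E) ((StdForm.antidiagonal 2).over E)) ↥(unitaryGroupOfForm (c : E →+* E) ((StdForm.antidiagonal 2).over E))) =>
        ((borelHeight ((quasiSplit F E c 2).toAdelic (Quotient.out q : ↥(unitaryGroupOfForm (c : E →+* E) ((StdForm.antidiagonal 2).over E))) * g) : ℝ)) ^ τ := by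
  letI : MeasurableSpace (quasiSplit F E c 2).Adelic := borel _
  haveI : BorelSpace (quasiSplit F E c 2).Adelic := ⟨rfl⟩
  haveI : T2Space (quasiSplit F E c 2).Adelic := inferInstanceAs (T2Space (adelic F E c 2 ((StdForm.antidiagonal 2).over E)))
  haveI : LocallyCompactSpace (quasiSplit F E c 2).Adelic := inferInstanceAs (LocallyCompactSpace (adelic F E c 2 ((StdForm.antidiagonal 2).over E)))
  exact summable_borelHeight_rpow_of_parabolicIntegral (Measure.haar) hIw (fun g => ⟨_, fun γ => borelHeight_toAdelic_mul_le_max_two γ g⟩)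
    (zero_le_one.trans hτ.le) (parabolicIntegral_borel_two hc hc1 hτ)

/-- The same with the locally uniform majorant (R4a shape on heights). [cite: MoeglinWaldspurger1995, II.1.5] [cite: Garrett2018, §2.8] -/
theorem exists_nhds_summable_majorant_borelHeight_rpow_two (hc : c * c = 1) (hc1 : c ≠ 1)
    (hIw : ∀ g : (quasiSplit F E c 2).Adelic, ∃ b ∈ borelAdelic F E c 2, ∃ k : (quasiSplit F E c 2).Adelic,
      adelicVal F E c 2 ((StdForm.antidiagonal 2).over E) k ∈ standardMaximalCompactGL 2 E ∧ g = b * k)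
    {τ : ℝ} (hτ : 1 < τ) (g₀ : (quasiSplit F E c 2).Adelic) :
    ∃ U ∈ 𝓝 g₀, ∃ u : Quotient (orbitRel ↥(borelU (c : E →+* E) ((StdForm.antidiagonal 2).over E)) ↥(unitaryGroupOfForm (c : E →+* E) ((StdForm.antidiagonal 2).over E))) → ℝ,
      Summable u ∧ ∀ g ∈ U, ∀ q,
        ((borelHeight ((quasiSplit F E c 2).toAdelic (Quotient.out q : ↥(unitaryGroupOfForm (c : E →+* E) ((StdForm.antidiagonal 2).over E))) * g) : ℝ)) ^ τ ≤ u q := by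
  letI : MeasurableSpace (quasiSplit F E c 2).Adelic := borel _
  haveI : BorelSpace (quasiSplit F E c 2).Adelic := ⟨rfl⟩
  haveI : T2Space (quasiSplit F E c 2).Adelic := inferInstanceAs (T2Space (adelic F E c 2 ((StdForm.antidiagonal 2).over E)))
  haveI : LocallyCompactSpace (quasiSplit F E c 2).Adelic := inferInstanceAs (LocallyCompactSpace (adelic F E c 2 ((StdForm.antidiagonal 2).over E)))
  exact exists_nhds_summable_majorant_borelHeight_rpow_of_parabolicIntegral (Measure.haar) hIw (fun g => ⟨_, fun γ => borelHeight_toAdelic_mul_le_max_two γ g⟩)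
    (zero_le_one.trans hτ.le) (parabolicIntegral_borel_two hc hc1 hτ) g₀

end Quadratic

/-! ## §2 The CM pair `(L⁺, L, c)`: no hypothesis left -/

section CM

variable (L : Type) [Field L] [NumberField L] [IsCMField L]

/-- **GODEMENT FOR `U(Φ₂)` OVER A CM FIELD — `Σ_{q ∈ B(L⁺)∖U(J₂)(L⁺)} H(γ̃_q g)^τ < ∞` for every `τ > 1` and every `g`**, unconditionally. [cite: Godement1964, §8] [cite: MoeglinWaldspurger1995, II.1.5]
[cite: Garrett2018, §2.8] [cite: Rogawski1990, §2.2] -/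
theorem summable_borelHeight_rpow_cm_two {τ : ℝ} (hτ : 1 < τ) :
    ∀ g : (quasiSplit (↥(maximalRealSubfield L)) L (IsCMField.complexConj L) 2).Adelic,
      Summable fun q : Quotient (orbitRel ↥(borelU ((IsCMField.complexConj L : L ≃ₐ[↥(maximalRealSubfield L)] L) : L →+* L) ((StdForm.antidiagonal 2).over L))
          ↥(unitaryGroupOfForm ((IsCMField.complexConj L : L ≃ₐ[↥(maximalRealSubfield L)] L) : L →+* L) ((StdForm.antidiagonal 2).over L))) =>
        ((borelHeight ((quasiSplit (↥(maximalRealSubfield L)) L (IsCMField.complexConj L) 2).toAdelic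
          (Quotient.out q : ↥(unitaryGroupOfForm ((IsCMField.complexConj L : L ≃ₐ[↥(maximalRealSubfield L)] L) : L →+* L) ((StdForm.antidiagonal 2).over L))) * g) : ℝ)) ^ τ :=
  summable_borelHeight_rpow_two (AlgEquiv.ext fun x => IsCMField.complexConj_apply_apply L x) (IsCMField.complexConj_ne_one L)
    (fun g => exists_mem_borelAdelic_mul_mem_standardMaximalCompactGL_cm L g) hτ

/-- **The locally uniform height majorant at the CM pair, `N = 2`.** [cite: MoeglinWaldspurger1995, II.1.5] [cite: Garrett2018, §2.8] -/
theorem exists_nhds_summable_majorant_borelHeight_rpow_cm_two {τ : ℝ} (hτ : 1 < τ) (g₀ : (quasiSplit (↥(maximalRealSubfield L)) L (IsCMField.complexConj L) 2).Adelic) :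
    ∃ U ∈ 𝓝 g₀, ∃ u : Quotient (orbitRel ↥(borelU ((IsCMField.complexConj L : L ≃ₐ[↥(maximalRealSubfield L)] L) : L →+* L) ((StdForm.antidiagonal 2).over L))
        ↥(unitaryGroupOfForm ((IsCMField.complexConj L : L ≃ₐ[↥(maximalRealSubfield L)] L) : L →+* L) ((StdForm.antidiagonal 2).over L))) → ℝ,
      Summable u ∧ ∀ g ∈ U, ∀ q,
        ((borelHeight ((quasiSplit (↥(maximalRealSubfield L)) L (IsCMField.complexConj L) 2).toAdelic
          (Quotient.out q : ↥(unitaryGroupOfForm ((IsCMField.complexConj L : L ≃ₐ[↥(maximalRealSubfield L)] L) : L →+* L) ((StdForm.antidiagonal 2).over L))) * g) : ℝ)) ^ τ ≤ u q :=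
  exists_nhds_summable_majorant_borelHeight_rpow_two (AlgEquiv.ext fun x => IsCMField.complexConj_apply_apply L x) (IsCMField.complexConj_ne_one L)
    (fun g => exists_mem_borelAdelic_mul_mem_standardMaximalCompactGL_cm L g) hτ g₀

/-- **GODEMENT'S CRITERION FOR THE BOREL EISENSTEIN SERIES OF `U(1,1)` OVER A CM FIELD, UNCONDITIONAL**: for `Re z > 1` (`Re s > ½`) and bounded `φ` (`‖φ‖ ≤ M`), the terms of
`eisensteinSeriesU (flatSectionU φ z) g` are absolutely summable for every `g`. [cite: Godement1964, §8] [cite: MoeglinWaldspurger1995, II.1.5] [cite: Garrett2018, §2.8] [cite: Rogawski1990, §2.2] -/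
theorem summable_eisensteinSeriesU_flatSectionU_cm_two {z : ℂ} (hz : 1 < z.re)
    {φ : (quasiSplit (↥(maximalRealSubfield L)) L (IsCMField.complexConj L) 2).Adelic → ℂ} {M : ℝ} (hφ : ∀ x, ‖φ x‖ ≤ M)
    (g : (quasiSplit (↥(maximalRealSubfield L)) L (IsCMField.complexConj L) 2).Adelic) :
    Summable fun q : Quotient (orbitRel ↥(borelU ((IsCMField.complexConj L : L ≃ₐ[↥(maximalRealSubfield L)] L) : L →+* L) ((StdForm.antidiagonal 2).over L))
        ↥(unitaryGroupOfForm ((IsCMField.complexConj L : L ≃ₐ[↥(maximalRealSubfield L)] L) : L →+* L) ((StdForm.antidiagonal 2).over L))) =>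
      ‖flatSectionU φ z ((quasiSplit (↥(maximalRealSubfield L)) L (IsCMField.complexConj L) 2).toAdelic
          (Quotient.out q : ↥(unitaryGroupOfForm ((IsCMField.complexConj L : L ≃ₐ[↥(maximalRealSubfield L)] L) : L →+* L) ((StdForm.antidiagonal 2).over L))) * g)‖ :=
  summable_norm_flatSectionU_of_summable hφ (summable_borelHeight_rpow_cm_two L hz g)

/-- **THE LOCALLY UNIFORM MAJORANT AT `N = 2`, UNCONDITIONAL (R4a shape)** — the 5Res rails. [cite: MoeglinWaldspurger1995, II.1.5] [cite: Garrett2018, §2.8] -/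
theorem exists_locallyUniform_majorant_flatSectionU_cm_two {z : ℂ} (hz : 1 < z.re)
    {φ : (quasiSplit (↥(maximalRealSubfield L)) L (IsCMField.complexConj L) 2).Adelic → ℂ} {M : ℝ} (hφ : ∀ x, ‖φ x‖ ≤ M)
    (g₀ : (quasiSplit (↥(maximalRealSubfield L)) L (IsCMField.complexConj L) 2).Adelic) :
    ∃ U ∈ 𝓝 g₀, ∃ u : Quotient (orbitRel ↥(borelU ((IsCMField.complexConj L : L ≃ₐ[↥(maximalRealSubfield L)] L) : L →+* L) ((StdForm.antidiagonal 2).over L))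
        ↥(unitaryGroupOfForm ((IsCMField.complexConj L : L ≃ₐ[↥(maximalRealSubfield L)] L) : L →+* L) ((StdForm.antidiagonal 2).over L))) → ℝ,
      Summable u ∧ ∀ g ∈ U, ∀ q,
        ‖flatSectionU φ z ((quasiSplit (↥(maximalRealSubfield L)) L (IsCMField.complexConj L) 2).toAdelic
          (Quotient.out q : ↥(unitaryGroupOfForm ((IsCMField.complexConj L : L ≃ₐ[↥(maximalRealSubfield L)] L) : L →+* L) ((StdForm.antidiagonal 2).over L))) * g)‖ ≤ u q := by
  obtain ⟨U, hU, hmaj⟩ := exists_nhds_summable_majorant_borelHeight_rpow_cm_two L hz g₀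
  exact ⟨U, hU, exists_majorant_flatSectionU_of_majorant hφ
    (y := fun q g => (quasiSplit (↥(maximalRealSubfield L)) L (IsCMField.complexConj L) 2).toAdelic
      (Quotient.out q : ↥(unitaryGroupOfForm ((IsCMField.complexConj L : L ≃ₐ[↥(maximalRealSubfield L)] L) : L →+* L) ((StdForm.antidiagonal 2).over L))) * g) hmaj⟩

end CM

end Summit.HodgeConjecture.HodgeConjecture.Cruxes.H413.K2E1BorelEisensteinGodementCMTwo

end
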